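/- Lead `ym-line-cbag-p1`, route `ColdBoxAllGroups`, crux `BoxFloorAllGroups` (stmt-QuantumFields-22254), line `birth`, stub S2, brick B8
«GaussSideD»: the Gaussian side of the one-scale expansion with `D` colours. -/
import Summits.QuantumFields.YangMills.Theorems.ColdBoxAllGroupsOneScaleDefs
import Summits.QuantumFields.YangMills.Theorems.WeakCouplingRatesColdBoxGaussMoments
import Summits.QuantumFields.YangMills.Theorems.WeakCouplingRatesColdBoxColourCov
import Summits.QuantumFields.YangMills.Theorems.WeakCouplingRatesColdBoxGauss3LargeField

/-!
# Crux `BoxFloorAllGroups`, stub S2, brick B8 «GaussSideD»: moments, colour identity and Gaussian large fields of the quadratic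
# surrogates `qObsD` under the `D`-colour reference `gaussD H D = boxDirichlet H ^{⊗D}`

`D`-colour port (verbatim in structure) of the `SU(2)` files `WeakCouplingRatesColdBoxGaussMoments` / `…ColourCov` / `…Gauss3LargeField`
(three colours, `gauss3`, `qObs`) to the objects `TSpaceD / gaussD / qObsD` of `Theorems/ColdBoxAllGroupsOneScaleDefs.lean`; the
one-colour inputs (`integral_dirCirc_pow_even_le`, `memLp_two_half_dirCirc_sq`, `cov_colourSum_pi`,
`measureReal_boxDirichlet_exists_abs_dirCirc_ge_le`, …) are the landed Dirichlet-Gaussian theorems.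

* power means for `D` terms: `(Σ_c x_c)² ≤ D·Σ x_c²`, `(Σ_c x_c)⁴ ≤ D³·Σ x_c⁴` (Cauchy–Schwarz);
* `integral_comp_eval_gaussD`, `integrable_comp_eval_gaussD` — colour marginals;
* `memLp_two_qObsD` — `qObsD p ∈ L²(gaussD)`, `∫ qObsD² ≤ D²`; `memLp_two_qObsD_mul_qObsD` — `∫ (qObsD p · qObsD q)² ≤ 7·D⁴`
  (Dirichlet variances `≤ 1`);
* **`cov_qObsD_gaussD_eq`** — the colour identity at the crux's plaquettes:
  `Cov_{gaussD}(qObsD p_c, qObsD (p_c + Te₀)) = (D/4)·boxDirCircSqCov H T` (`H ≥ 1`, `T ≤ H`) — the Gaussian constant `D/4` of S2;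
* `measureReal_gaussD_exists_abs_dirCirc_ge_le`, `measureReal_gaussD_not_smallField_le` — Gaussian large fields:
  `gaussD{∃ i p, R ≤ |s_i(p)|} ≤ 2D·#Λ'·e^{−R²/2} ≤ 240·D·(2H+1)⁴·e^{−R²/2}`; `qObsD_le_of_smallField` — `qObsD ≤ (D/2)·R²` on the small-field region.
No sorry; no new definition; standard axioms.  NOT a claim about the mass gap (rung-level support, RECORD label).
-/

set_option autoImplicit false

noncomputable section

open MeasureTheory ProbabilityTheory Finset
open scoped Nat NNReal
open Literature.Probability.LatticeModels (Site halfOpenBox)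
open Literature.MathematicalPhysics.QuantumLattice
open Literature.MathematicalPhysics.QuantumFieldTheory
open Literature.MathematicalPhysics.QuantumFieldTheory.LatticeMaxwell
open Literature.MathematicalPhysics.QuantumFieldTheory.AxialGauge
open Summit.QuantumFields.YangMills.Theorems.WeakCouplingRates

namespace Summit.QuantumFields.YangMills.Theorems.ColdBoxAllGroups

variable {H D : ℕ}

/-! ## Power-mean inequalities for `D` terms -/

/-- `(Σ_c x_c)² ≤ D · Σ_c x_c²` (Cauchy–Schwarz). -/
theorem sq_sum_le_card_mul_sum_sq (x : Fin D → ℝ) : (∑ c, x c) ^ 2 ≤ (D : ℝ) * ∑ c, x c ^ 2 := by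
  have h := Finset.sum_mul_sq_le_sq_mul_sq (Finset.univ : Finset (Fin D)) x (fun _ => (1 : ℝ))
  simp only [mul_one, one_pow, Finset.sum_const, Finset.card_univ, Fintype.card_fin, nsmul_eq_mul] at h
  linarith

/-- `(Σ_c x_c)⁴ ≤ D³ · Σ_c x_c⁴`. -/
theorem pow_four_sum_le (x : Fin D → ℝ) : (∑ c, x c) ^ 4 ≤ (D : ℝ) ^ 3 * ∑ c, x c ^ 4 := by
  have h1 := sq_sum_le_card_mul_sum_sq x
  have h2 := sq_sum_le_card_mul_sum_sq (fun c => x c ^ 2)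
  have h0 : 0 ≤ (∑ c, x c) ^ 2 := sq_nonneg _
  have hD : (0 : ℝ) ≤ D := Nat.cast_nonneg _
  have e4 : ∀ c, (x c ^ 2) ^ 2 = x c ^ 4 := fun c => by ring
  simp only [e4] at h2
  calc (∑ c, x c) ^ 4 = ((∑ c, x c) ^ 2) ^ 2 := by ring
    _ ≤ ((D : ℝ) * ∑ c, x c ^ 2) ^ 2 := pow_le_pow_left₀ h0 h1 2
    _ = (D : ℝ) ^ 2 * (∑ c, x c ^ 2) ^ 2 := by ring
    _ ≤ (D : ℝ) ^ 2 * ((D : ℝ) * ∑ c, x c ^ 4) := mul_le_mul_of_nonneg_left h2 (by positivity)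
    _ = (D : ℝ) ^ 3 * ∑ c, x c ^ 4 := by ring

/-! ## Colour marginals of `gaussD` -/

/-- Colour marginals: `∫ f(t c) d(gaussD) = ∫ f d(boxDirichlet)`. -/
theorem integral_comp_eval_gaussD (f : EuclideanSpace ℝ (DirFree H) → ℝ) (c : Fin D) :
    ∫ t, f (t c) ∂(gaussD H D) = ∫ s, f s ∂(boxDirichlet H) := by
  unfold gaussD; exact integral_pi_eval _ f c

/-- Integrability of a colour marginal. -/
theorem integrable_comp_eval_gaussD {f : EuclideanSpace ℝ (DirFree H) → ℝ} (hfm : Measurable f)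
    (hf : Integrable f (boxDirichlet H)) (c : Fin D) : Integrable (fun t : TSpaceD H D => f (t c)) (gaussD H D) := by
  have hmp : MeasurePreserving (fun t : TSpaceD H D => t c) (gaussD H D) (boxDirichlet H) := by
    unfold gaussD; exact measurePreserving_eval _ c
  exact (integrable_map_measure (μ := gaussD H D) (f := fun t : TSpaceD H D => t c) (g := f)
    (by rw [hmp.map_eq]; exact hfm.aestronglyMeasurable) (measurable_pi_apply c).aemeasurable).1 (by rw [hmp.map_eq]; exact hf)

/-- `gaussD{t : t_i ∈ A} = boxDirichlet(A)` for measurable `A`. -/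
theorem measureReal_gaussD_colour_preimage (i : Fin D) {A : Set (EuclideanSpace ℝ (DirFree H))} (hA : MeasurableSet A) :
    (gaussD H D).real {t | t i ∈ A} = (boxDirichlet H).real A := by
  have h := (MeasureTheory.measurePreserving_eval (μ := fun _ : Fin D => boxDirichlet H) i).measure_preimage hA.nullMeasurableSet
  rw [measureReal_def, measureReal_def]
  exact congrArg ENNReal.toReal h

/-! ## Moments of the surrogates under `gaussD` -/

/-- Pointwise: `qObsD² ≤ (D/4) Σ_c s_c⁴`. -/
theorem qObsD_sq_le (p : Plaq 4) (t : TSpaceD H D) : qObsD H D p t ^ 2 ≤ (D : ℝ) / 4 * ∑ c, dirCirc H p (t c) ^ 4 := by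
  have h := sq_sum_le_card_mul_sum_sq (fun c => dirCirc H p (t c) ^ 2)
  have e4 : ∀ c, (dirCirc H p (t c) ^ 2) ^ 2 = dirCirc H p (t c) ^ 4 := fun c => by ring
  simp only [e4] at h
  rw [qObsD]
  nlinarith

/-- Pointwise: `qObsD⁴ ≤ (D³/16) Σ_c s_c⁸`. -/
theorem qObsD_pow_four_le (p : Plaq 4) (t : TSpaceD H D) : qObsD H D p t ^ 4 ≤ (D : ℝ) ^ 3 / 16 * ∑ c, dirCirc H p (t c) ^ 8 := by
  have h := pow_four_sum_le (fun c => dirCirc H p (t c) ^ 2)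
  have e8 : ∀ c, (dirCirc H p (t c) ^ 2) ^ 4 = dirCirc H p (t c) ^ 8 := fun c => by ring
  simp only [e8] at h
  have e2 : qObsD H D p t ^ 4 = 1 / 16 * (∑ c, dirCirc H p (t c) ^ 2) ^ 4 := by rw [qObsD]; ring
  rw [e2]
  nlinarith

/-- Integrability of `Σ_c s_c^{2r}` under `gaussD` and its integral bound `D·(2r−1)!!`. -/
theorem integral_sum_dirCirc_pow_even_le_D (p : Plaq 4) (hvar : ∫ s, dirCirc H p s ^ 2 ∂(boxDirichlet H) ≤ 1) (r : ℕ) :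
    Integrable (fun t : TSpaceD H D => ∑ c, dirCirc H p (t c) ^ (2 * r)) (gaussD H D) ∧
      ∫ t, ∑ c, dirCirc H p (t c) ^ (2 * r) ∂(gaussD H D) ≤ (D : ℝ) * ((2 * r - 1 : ℕ)‼ : ℝ) := by
  obtain ⟨hint, hle⟩ := integral_dirCirc_pow_even_le p hvar r
  have hc : ∀ c : Fin D, Integrable (fun t : TSpaceD H D => dirCirc H p (t c) ^ (2 * r)) (gaussD H D) := fun c =>
    integrable_comp_eval_gaussD ((measurable_dirCirc p).pow_const _) hint c
  refine ⟨integrable_finsetSum _ fun c _ => hc c, ?_⟩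
  rw [integral_finsetSum _ fun c _ => hc c]
  calc ∑ c : Fin D, ∫ t, dirCirc H p (t c) ^ (2 * r) ∂(gaussD H D) = ∑ _c : Fin D, ∫ s, dirCirc H p s ^ (2 * r) ∂(boxDirichlet H) :=
        Finset.sum_congr rfl fun c _ => integral_comp_eval_gaussD (fun s => dirCirc H p s ^ (2 * r)) c
    _ ≤ ∑ _c : Fin D, ((2 * r - 1 : ℕ)‼ : ℝ) := Finset.sum_le_sum fun c _ => hle
    _ = _ := by rw [Finset.sum_const, Finset.card_univ, Fintype.card_fin, nsmul_eq_mul]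

/-- **Second moment of the surrogate**: `qObsD p ∈ L²(gaussD)` and `∫ qObsD² d(gaussD) ≤ D²`, for `E_D[s(p)²] ≤ 1`. -/
theorem memLp_two_qObsD (p : Plaq 4) (hvar : ∫ s, dirCirc H p s ^ 2 ∂(boxDirichlet H) ≤ 1) :
    MemLp (qObsD H D p) 2 (gaussD H D) ∧ ∫ t, qObsD H D p t ^ 2 ∂(gaussD H D) ≤ (D : ℝ) ^ 2 := by
  obtain ⟨hint4, hle4⟩ := integral_sum_dirCirc_pow_even_le_D (D := D) p hvar 2
  have hD : (0 : ℝ) ≤ D := Nat.cast_nonneg _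
  have hdom : Integrable (fun t : TSpaceD H D => (D : ℝ) / 4 * ∑ c, dirCirc H p (t c) ^ 4) (gaussD H D) := hint4.const_mul _
  have hsq : Integrable (fun t => qObsD H D p t ^ 2) (gaussD H D) :=
    hdom.mono' (((measurable_qObsD D p).pow_const 2).aestronglyMeasurable) (ae_of_all _ fun t => by
      rw [Real.norm_eq_abs, abs_of_nonneg (sq_nonneg _)]; exact qObsD_sq_le p t)
  refine ⟨(memLp_two_iff_integrable_sq (measurable_qObsD D p).aestronglyMeasurable).2 hsq, ?_⟩
  calc ∫ t, qObsD H D p t ^ 2 ∂(gaussD H D) ≤ ∫ t, (D : ℝ) / 4 * ∑ c, dirCirc H p (t c) ^ 4 ∂(gaussD H D) :=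
        integral_mono hsq hdom fun t => qObsD_sq_le p t
    _ = (D : ℝ) / 4 * ∫ t, ∑ c, dirCirc H p (t c) ^ 4 ∂(gaussD H D) := integral_const_mul _ _
    _ ≤ (D : ℝ) / 4 * ((D : ℝ) * ((2 * 2 - 1 : ℕ)‼ : ℝ)) := by gcongr
    _ ≤ (D : ℝ) ^ 2 := by norm_num [Nat.doubleFactorial]; nlinarith

/-- **Second moment of a product of surrogates**: `qObsD p · qObsD q ∈ L²(gaussD)` and `∫ (qObsD p · qObsD q)² d(gaussD) ≤ 7·D⁴`. -/
theorem memLp_two_qObsD_mul_qObsD (p q : Plaq 4) (hp : ∫ s, dirCirc H p s ^ 2 ∂(boxDirichlet H) ≤ 1)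
    (hq : ∫ s, dirCirc H q s ^ 2 ∂(boxDirichlet H) ≤ 1) :
    MemLp (fun t => qObsD H D p t * qObsD H D q t) 2 (gaussD H D) ∧
      ∫ t, (qObsD H D p t * qObsD H D q t) ^ 2 ∂(gaussD H D) ≤ 7 * (D : ℝ) ^ 4 := by
  obtain ⟨hint8p, hle8p⟩ := integral_sum_dirCirc_pow_even_le_D (D := D) p hp 4
  obtain ⟨hint8q, hle8q⟩ := integral_sum_dirCirc_pow_even_le_D (D := D) q hq 4
  have hD : (0 : ℝ) ≤ D := Nat.cast_nonneg _
  set B : TSpaceD H D → ℝ := fun t => (D : ℝ) ^ 3 / 32 * (∑ c, dirCirc H p (t c) ^ 8 + ∑ c, dirCirc H q (t c) ^ 8) with hB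
  have hdom : Integrable B (gaussD H D) := (hint8p.add hint8q).const_mul _
  have hpt : ∀ t, (qObsD H D p t * qObsD H D q t) ^ 2 ≤ B t := fun t => by
    have h1 := qObsD_pow_four_le p t
    have h2 := qObsD_pow_four_le q t
    have hamgm : (qObsD H D p t * qObsD H D q t) ^ 2 ≤ (qObsD H D p t ^ 4 + qObsD H D q t ^ 4) / 2 := by
      nlinarith [sq_nonneg (qObsD H D p t ^ 2 - qObsD H D q t ^ 2)]
    simp only [hB]
    linarith
  have hmeas : Measurable fun t => qObsD H D p t * qObsD H D q t := (measurable_qObsD D p).mul (measurable_qObsD D q)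
  have hsq : Integrable (fun t => (qObsD H D p t * qObsD H D q t) ^ 2) (gaussD H D) :=
    hdom.mono' ((hmeas.pow_const 2).aestronglyMeasurable) (ae_of_all _ fun t => by
      rw [Real.norm_eq_abs, abs_of_nonneg (sq_nonneg _)]; exact hpt t)
  refine ⟨(memLp_two_iff_integrable_sq hmeas.aestronglyMeasurable).2 hsq, ?_⟩
  calc ∫ t, (qObsD H D p t * qObsD H D q t) ^ 2 ∂(gaussD H D) ≤ ∫ t, B t ∂(gaussD H D) := integral_mono hsq hdom hpt
    _ = (D : ℝ) ^ 3 / 32 * ((∫ t, ∑ c, dirCirc H p (t c) ^ 8 ∂(gaussD H D)) + ∫ t, ∑ c, dirCirc H q (t c) ^ 8 ∂(gaussD H D)) := by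
        simp only [hB]; rw [integral_const_mul, integral_add hint8p hint8q]
    _ ≤ (D : ℝ) ^ 3 / 32 * ((D : ℝ) * ((2 * 4 - 1 : ℕ)‼ : ℝ) + (D : ℝ) * ((2 * 4 - 1 : ℕ)‼ : ℝ)) := by gcongr
    _ ≤ 7 * (D : ℝ) ^ 4 := by norm_num [Nat.doubleFactorial]; nlinarith [pow_nonneg hD 4]

/-! ## The colour identity: the Gaussian constant `D/4` -/

/-- **Colour identity (general plaquettes)**: for plaquettes `p, q` with Dirichlet variances `≤ 1`,
`Cov_{gaussD}(qObsD p, qObsD q) = (D/4) · (E_D[s(p)²s(q)²] − E_D[s(p)²]E_D[s(q)²])`. -/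
theorem cov_qObsD_gaussD_eq_general (p q : Plaq 4) (hp : ∫ s, dirCirc H p s ^ 2 ∂(boxDirichlet H) ≤ 1)
    (hq : ∫ s, dirCirc H q s ^ 2 ∂(boxDirichlet H) ≤ 1) :
    (∫ t, qObsD H D p t * qObsD H D q t ∂(gaussD H D)) - (∫ t, qObsD H D p t ∂(gaussD H D)) * (∫ t, qObsD H D q t ∂(gaussD H D)) =
      (D : ℝ) / 4 * ((∫ s, dirCirc H p s ^ 2 * dirCirc H q s ^ 2 ∂(boxDirichlet H)) -
        (∫ s, dirCirc H p s ^ 2 ∂(boxDirichlet H)) * (∫ s, dirCirc H q s ^ 2 ∂(boxDirichlet H))) := by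
  have h := cov_colourSum_pi (ι := Fin D) (boxDirichlet H) (fun s => 1 / 2 * dirCirc H p s ^ 2) (fun s => 1 / 2 * dirCirc H q s ^ 2)
    (memLp_two_half_dirCirc_sq p hp) (memLp_two_half_dirCirc_sq q hq)
  simp only [← qObsD_eq_sum] at h
  rw [gaussD, h, Fintype.card_fin]
  have e1 : ∫ s, 1 / 2 * dirCirc H p s ^ 2 * (1 / 2 * dirCirc H q s ^ 2) ∂(boxDirichlet H) =
      1 / 4 * ∫ s, dirCirc H p s ^ 2 * dirCirc H q s ^ 2 ∂(boxDirichlet H) := by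
    rw [← integral_const_mul]; refine integral_congr_ae (ae_of_all _ fun s => ?_); ring
  have e2 : ∫ s, 1 / 2 * dirCirc H p s ^ 2 ∂(boxDirichlet H) = 1 / 2 * ∫ s, dirCirc H p s ^ 2 ∂(boxDirichlet H) :=
    integral_const_mul _ _
  have e3 : ∫ s, 1 / 2 * dirCirc H q s ^ 2 ∂(boxDirichlet H) = 1 / 2 * ∫ s, dirCirc H q s ^ 2 ∂(boxDirichlet H) :=
    integral_const_mul _ _
  rw [e1, e2, e3]
  ring

/-- **Colour identity at the crux's plaquettes**: `Cov_{gaussD}(qObsD p_c, qObsD (p_c + Te₀)) = (D/4) · boxDirCircSqCov H T`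
(`H ≥ 1`, `T ≤ H`) — the Gaussian constant of S2. -/
theorem cov_qObsD_gaussD_eq (hH : 1 ≤ H) {T : ℕ} (hT : T ≤ H) :
    (∫ t, qObsD H D (plaq12At (boxCentre H)) t * qObsD H D (plaq12At (boxCentre H + Pi.single 0 (T : ℤ))) t ∂(gaussD H D)) -
        (∫ t, qObsD H D (plaq12At (boxCentre H)) t ∂(gaussD H D)) *
          (∫ t, qObsD H D (plaq12At (boxCentre H + Pi.single 0 (T : ℤ))) t ∂(gaussD H D)) =
      (D : ℝ) / 4 * boxDirCircSqCov H T := by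
  obtain ⟨hp, hq⟩ := integral_dirCirc_sq_le_one_centre hH hT
  rw [cov_qObsD_gaussD_eq_general _ _ hp hq, boxDirCircSqCov]

/-- The moment bounds at the crux's plaquettes (`H ≥ 1`, `T ≤ H`): `qObsD ∈ L²`, `∫ qObsD² ≤ D²` for both, and
`∫ (qObsD p_c · qObsD (p_c+Te₀))² ≤ 7D⁴`. -/
theorem moments_qObsD_centre (hH : 1 ≤ H) {T : ℕ} (hT : T ≤ H) :
    (MemLp (qObsD H D (plaq12At (boxCentre H))) 2 (gaussD H D) ∧
        ∫ t, qObsD H D (plaq12At (boxCentre H)) t ^ 2 ∂(gaussD H D) ≤ (D : ℝ) ^ 2) ∧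
      (MemLp (qObsD H D (plaq12At (boxCentre H + Pi.single 0 (T : ℤ)))) 2 (gaussD H D) ∧
        ∫ t, qObsD H D (plaq12At (boxCentre H + Pi.single 0 (T : ℤ))) t ^ 2 ∂(gaussD H D) ≤ (D : ℝ) ^ 2) ∧
      (MemLp (fun t => qObsD H D (plaq12At (boxCentre H)) t * qObsD H D (plaq12At (boxCentre H + Pi.single 0 (T : ℤ))) t) 2 (gaussD H D) ∧
        ∫ t, (qObsD H D (plaq12At (boxCentre H)) t * qObsD H D (plaq12At (boxCentre H + Pi.single 0 (T : ℤ))) t) ^ 2 ∂(gaussD H D) ≤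
          7 * (D : ℝ) ^ 4) := by
  obtain ⟨hp, hq⟩ := integral_dirCirc_sq_le_one_centre hH hT
  exact ⟨memLp_two_qObsD _ hp, memLp_two_qObsD _ hq, memLp_two_qObsD_mul_qObsD _ _ hp hq⟩

/-! ## Gaussian large fields, `D` colours -/

/-- **Gaussian large fields, `D` colours**: for `R ≥ 0`,
`gaussD{∃ i, ∃ p touching Λ_H, R ≤ |s_i(p)|} ≤ 2D·#(plaquettesTouching Λ_H)·e^{−R²/2}`. -/
theorem measureReal_gaussD_exists_abs_dirCirc_ge_le (H D : ℕ) {R : ℝ} (hR : 0 ≤ R) :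
    (gaussD H D).real {t | ∃ i : Fin D, ∃ p ∈ plaquettesTouching (boxEdges 4 (2 * H + 1)), R ≤ |dirCirc H (p.1, p.2.1.1, p.2.1.2) (t i)|} ≤
      2 * D * #(plaquettesTouching (boxEdges 4 (2 * H + 1))) * Real.exp (-R ^ 2 / 2) := by
  set A : Set (EuclideanSpace ℝ (DirFree H)) :=
    {s | ∃ p ∈ plaquettesTouching (boxEdges 4 (2 * H + 1)), R ≤ |dirCirc H (p.1, p.2.1.1, p.2.1.2) s|} with hA
  have hAm : MeasurableSet A := measurableSet_exists_abs_dirCirc_ge H R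
  have hset : {t : TSpaceD H D | ∃ i : Fin D, ∃ p ∈ plaquettesTouching (boxEdges 4 (2 * H + 1)), R ≤ |dirCirc H (p.1, p.2.1.1, p.2.1.2) (t i)|} =
      ⋃ i ∈ (Finset.univ : Finset (Fin D)), {t : TSpaceD H D | t i ∈ A} := by
    ext t; simp [hA]
  rw [hset]
  refine (measureReal_biUnion_finset_le _ _).trans ?_
  have hone : ∀ i : Fin D, (gaussD H D).real {t : TSpaceD H D | t i ∈ A} ≤
      2 * #(plaquettesTouching (boxEdges 4 (2 * H + 1))) * Real.exp (-R ^ 2 / 2) := by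
    intro i
    rw [measureReal_gaussD_colour_preimage i hAm]
    exact measureReal_boxDirichlet_exists_abs_dirCirc_ge_le H hR
  calc ∑ i ∈ (Finset.univ : Finset (Fin D)), (gaussD H D).real {t : TSpaceD H D | t i ∈ A}
      ≤ ∑ _i ∈ (Finset.univ : Finset (Fin D)), 2 * #(plaquettesTouching (boxEdges 4 (2 * H + 1))) * Real.exp (-R ^ 2 / 2) :=
        Finset.sum_le_sum fun i _ => hone i
    _ = 2 * D * #(plaquettesTouching (boxEdges 4 (2 * H + 1))) * Real.exp (-R ^ 2 / 2) := by
        rw [Finset.sum_const, Finset.card_univ, Fintype.card_fin, nsmul_eq_mul]; ring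

/-- **Complement form**: for `R ≥ 0` the `gaussD`-mass of the complement of «every colour circulation of every plaquette of `ℤ⁴` is at most
`R` in absolute value» is at most `240·D·(2H+1)⁴·e^{−R²/2}`. -/
theorem measureReal_gaussD_not_smallField_le (H D : ℕ) {R : ℝ} (hR : 0 ≤ R) :
    (gaussD H D).real {t | ¬ ∀ i : Fin D, ∀ p : ZdPlaquette 4, |dirCirc H (p.1, p.2.1.1, p.2.1.2) (t i)| ≤ R} ≤
      240 * D * (2 * (H : ℝ) + 1) ^ 4 * Real.exp (-R ^ 2 / 2) := by
  have hsub : {t : TSpaceD H D | ¬ ∀ i : Fin D, ∀ p : ZdPlaquette 4, |dirCirc H (p.1, p.2.1.1, p.2.1.2) (t i)| ≤ R} ⊆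
      {t | ∃ i : Fin D, ∃ p ∈ plaquettesTouching (boxEdges 4 (2 * H + 1)), R ≤ |dirCirc H (p.1, p.2.1.1, p.2.1.2) (t i)|} := by
    intro t ht
    simp only [Set.mem_setOf_eq, not_forall, not_le] at ht ⊢
    obtain ⟨i, p, hp⟩ := ht
    by_cases hmem : p ∈ plaquettesTouching (boxEdges 4 (2 * H + 1))
    · exact ⟨i, p, hmem, hp.le⟩
    · exfalso
      have h0 : dirCirc H (p.1, p.2.1.1, p.2.1.2) (t i) = 0 := sCirc_dirGlue_eq_zero_of_not_touching _ hmem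
      rw [h0, abs_zero] at hp
      linarith
  have hcard : (#(plaquettesTouching (boxEdges 4 (2 * H + 1))) : ℝ) ≤ 120 * (2 * (H : ℝ) + 1) ^ 4 := by
    have h := card_plaquettesTouching_boxEdges_le (2 * H + 1)
    have : ((#(plaquettesTouching (boxEdges 4 (2 * H + 1))) : ℕ) : ℝ) ≤ ((120 * (2 * H + 1) ^ 4 : ℕ) : ℝ) := by exact_mod_cast h
    push_cast at this
    exact this
  have hD : (0 : ℝ) ≤ D := Nat.cast_nonneg _
  calc (gaussD H D).real {t | ¬ ∀ i : Fin D, ∀ p : ZdPlaquette 4, |dirCirc H (p.1, p.2.1.1, p.2.1.2) (t i)| ≤ R}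
      ≤ (gaussD H D).real {t | ∃ i : Fin D, ∃ p ∈ plaquettesTouching (boxEdges 4 (2 * H + 1)), R ≤ |dirCirc H (p.1, p.2.1.1, p.2.1.2) (t i)|} :=
        measureReal_mono hsub
    _ ≤ 2 * D * #(plaquettesTouching (boxEdges 4 (2 * H + 1))) * Real.exp (-R ^ 2 / 2) :=
        measureReal_gaussD_exists_abs_dirCirc_ge_le H D hR
    _ ≤ 2 * D * (120 * (2 * (H : ℝ) + 1) ^ 4) * Real.exp (-R ^ 2 / 2) := by gcongr
    _ = 240 * D * (2 * (H : ℝ) + 1) ^ 4 * Real.exp (-R ^ 2 / 2) := by ring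

/-- **The Gaussian surrogate is bounded on the small-field region**: if every colour circulation of `p` is at most `R` in absolute value
then `qObsD H D p t ≤ (D/2)·R²`. -/
theorem qObsD_le_of_smallField (p : Plaq 4) (t : TSpaceD H D) {R : ℝ} (h : ∀ i : Fin D, |dirCirc H p (t i)| ≤ R) :
    qObsD H D p t ≤ (D : ℝ) / 2 * R ^ 2 := by
  unfold qObsD
  have hle : ∀ i : Fin D, dirCirc H p (t i) ^ 2 ≤ R ^ 2 := fun i => by
    have := h i
    rw [← sq_abs]
    exact pow_le_pow_left₀ (abs_nonneg _) this 2
  have hs : ∑ i : Fin D, dirCirc H p (t i) ^ 2 ≤ ∑ _i : Fin D, R ^ 2 := Finset.sum_le_sum fun i _ => hle i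
  rw [Finset.sum_const, Finset.card_univ, Fintype.card_fin, nsmul_eq_mul] at hs
  linarith

/-- The sum of squares of the colour components of one edge is at most `D·M²` when each circulation/edge value is bounded by `M`
(bookkeeping for the link radius on the small-field region). -/
theorem sum_sq_le_card_mul_sq {M : ℝ} (x : Fin D → ℝ) (h : ∀ i, |x i| ≤ M) : ∑ i, x i ^ 2 ≤ (D : ℝ) * M ^ 2 := by
  have hle : ∀ i : Fin D, x i ^ 2 ≤ M ^ 2 := fun i => by
    rw [← sq_abs]; exact pow_le_pow_left₀ (abs_nonneg _) (h i) 2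
  have hs : ∑ i : Fin D, x i ^ 2 ≤ ∑ _i : Fin D, M ^ 2 := Finset.sum_le_sum fun i _ => hle i
  rwa [Finset.sum_const, Finset.card_univ, Fintype.card_fin, nsmul_eq_mul] at hs

end Summit.QuantumFields.YangMills.Theorems.ColdBoxAllGroups

end
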